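import Mathlib
import HarnessLib
import Summits.Langlands.Langlands.Theses.DegenerateLimits

/-!
# DegenerateLimits — proof of the layer-1 glue `TargetOfCruxes` (stmt-Langlands-2633)

`TargetOfCruxes : CongruencesToRegular → RegularSatakeA → SatakeFieldFinite → GaloisRepOfLadicLimit →
OddPolarizableSatakeA` (route-Langlands-DegenerateLimits, binder `h₅` of its deciding theorem
`closes … := h₆ (h₅ h₁ h₂ h₃ h₄)`).

Proof (the planner's recipe, made precise).  Fix `π` in the odd polarizable `L`-algebraic sector
over the CM field `F`, a prime `ℓ` and `ι`.  CHOICE OF SATAKE DATA: let `R` be the set of finite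
places where `π` has NO Satake parameter — finite by the Flath hypothesis of the target — and choose
a Satake parameter `α v` at every `v ∉ R` (junk `0` on `R`); put `P v := arithFrobPolyOfSatake ι q_v 1 (α v)`.
DATA FROM THE CRUXES: `S₀` (uniform exceptional set of `RegularSatakeA`), `S ⊇ S₀` and the regular
`L`-algebraic approximants `π_m` (`CongruencesToRegular`), `(E, S_E)` with `E/ℚ_ℓ` finite holding
all coefficients of the `P v`, `v ∉ S_E` (`SatakeFieldFinite`).  INTERPOLATION: apply
`GaloisRepOfLadicLimit` with the finite set `S ∪ S_E ∪ R` and the family `P`: its coefficient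
hypothesis is `SatakeFieldFinite` at the chosen `α v`; its `m`-th approximation hypothesis is
witnessed by `ρ'_m := ρ(π_m)` from `RegularSatakeA` (at `v ∉ S₀`, `v ∤ ℓ`) evaluated at the Satake
parameter `α'_v` of `π_m` that `CongruencesToRegular` puts `ℓ^{-m}`-close to `α v`.  The output is a
semisimple `ρ`, unramified with `charpoly(Frob_v) = P v` off `S ∪ S_E ∪ R` and away from `ℓ`;
since only finitely many places divide `ℓ` (`Ideal.finite_factors`), `SatakeFrobCompatibleAt ι π ρ v`
holds for almost every `v`, witnessed by the chosen `α v`.  No uniqueness of Satake parameters is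
used (the target is existential in `α`).  Pure logic + finiteness bookkeeping over the four
antecedents; no definition, no named unproved fact as a hypothesis, no `sorry`.
References: N. Fakhruddin, V. Pilloni, *Hecke operators and the coherent cohomology of Shimura
varieties*, J. Inst. Math. Jussieu (2021), Thm. 9.10 [FakhruddinPilloni2021]; R. Taylor, *Galois
representations associated to Siegel modular forms of low weight*, Duke Math. J. 63 (1991), Thm. 1
[Taylor1991].
-/

set_option linter.dupNamespace false

namespace Summit.Langlands.Langlands.Theorems.DegenerateLimitsTargetOfCruxes

open Filter IsDedekindDomain NumberField
open Literature.NumberTheory.Automorphic Literature.NumberTheory.GaloisRepresentations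
open Summit.Langlands.Langlands.Theses
open Summit.Langlands.Langlands.Theses.DegenerateLimits

/-- **`TargetOfCruxes` holds** (stmt-Langlands-2633, proved outright): congruences to regular
forms, the regular Satake theorem with a uniform exceptional set, finiteness of the Satake
coefficient field and the `ℓ`-adic interpolation lemma imply Satake-level semisimple automorphy-to-
Galois in the odd polarizable `L`-algebraic sector — choose Satake parameters off the finite
non-Flath set `R`, interpolate over `S ∪ S_E ∪ R`, discard the finitely many places above `ℓ`.
[folklore] -/
theorem targetOfCruxes_proof :
    Summit.Langlands.Langlands.Theses.DegenerateLimits.TargetOfCruxes := by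
  intro h₁ h₂ h₃ h₄ F _ _ _ n hcpt π hT hpol hFl ℓ _ ι
  classical
  -- (0) choice of Satake parameters off the finite non-Flath set `R`
  set R : Set (HeightOneSpectrum (𝓞 F)) := {v | ¬ ∃ α : Multiset ℂ, π.1.HasSatakeParamAt v α}
    with hRdef
  have hRfin : R.Finite := Filter.eventually_cofinite.1 hFl
  let α : HeightOneSpectrum (𝓞 F) → Multiset ℂ := fun v =>
    if h : ∃ a : Multiset ℂ, π.1.HasSatakeParamAt v a then h.choose else 0
  have hα : ∀ v ∉ R, π.1.HasSatakeParamAt v (α v) := by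
    intro v hv
    have h : ∃ a : Multiset ℂ, π.1.HasSatakeParamAt v a := by
      by_contra h'
      exact hv h'
    simp only [α, dif_pos h]
    exact h.choose_spec
  let P : HeightOneSpectrum (𝓞 F) → Polynomial (PadicAlgCl ℓ) := fun v =>
    arithFrobPolyOfSatake ι v.residueCard 1 (α v)
  -- (1) data from the cruxes
  obtain ⟨S₀, hS₀fin, hreg⟩ := h₂ F n hcpt ℓ ι
  obtain ⟨S, hS₀S, hSfin, hcong⟩ := h₁ F n hcpt π hT hpol ℓ ι S₀ hS₀fin
  obtain ⟨E, SE, hE, hSEfin, hcoef⟩ := h₃ F n hcpt π hT hpol ℓ ι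
  have hfin : (S ∪ SE ∪ R).Finite := (hSfin.union hSEfin).union hRfin
  -- (2) the two hypotheses of the interpolation lemma
  have hPE : ∀ v ∉ S ∪ SE ∪ R, ∀ k : ℕ, (P v).coeff k ∈ E := by
    intro v hv k
    have hvSE : v ∉ SE := fun h => hv (Set.mem_union_left _ (Set.mem_union_right _ h))
    have hvR : v ∉ R := fun h => hv (Set.mem_union_right _ h)
    exact hcoef v hvSE (α v) (hα v hvR) k
  have happrox : ∀ m : ℕ, ∃ ρ' : FramedGaloisRep F (PadicAlgCl ℓ) n, ∀ v ∉ S ∪ SE ∪ R,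
      ((ℓ : ℕ) : 𝓞 F) ∉ v.asIdeal → ρ'.IsUnramifiedAt v ∧ ∃ Q : Polynomial (PadicAlgCl ℓ),
        ρ'.HasFrobCharpolyAt v Q ∧ ∀ k : ℕ, ‖Q.coeff k - (P v).coeff k‖ ≤ (ℓ : ℝ) ^ (-(m : ℤ)) := by
    intro m
    obtain ⟨π', hT', hπ'⟩ := hcong m
    obtain ⟨ρ', hρ'⟩ := hreg π' hT'
    refine ⟨ρ', fun v hv hvℓ => ?_⟩
    have hvS : v ∉ S := fun h => hv (Set.mem_union_left _ (Set.mem_union_left _ h))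
    have hvS₀ : v ∉ S₀ := fun h => hvS (hS₀S h)
    have hvR : v ∉ R := fun h => hv (Set.mem_union_right _ h)
    obtain ⟨α', hα', hbound⟩ := hπ' v hvS (α v) (hα v hvR)
    obtain ⟨hu', hP'⟩ := hρ' v hvS₀ hvℓ α' hα'
    exact ⟨hu', _, hP', hbound⟩
  -- (3) interpolate and discard the finitely many places above `ℓ`
  obtain ⟨ρ, hss, hρ⟩ := h₄ F n ℓ E hE (S ∪ SE ∪ R) hfin P hPE happrox
  refine ⟨ρ, hss, ?_⟩
  have away : ∀ᶠ v : HeightOneSpectrum (𝓞 F) in cofinite, ((ℓ : ℕ) : 𝓞 F) ∉ v.asIdeal := by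
    have h0 : (Ideal.span {((ℓ : ℕ) : 𝓞 F)} : Ideal (𝓞 F)) ≠ ⊥ := by
      rw [Ne, Ideal.span_singleton_eq_bot]
      exact_mod_cast (Fact.out : ℓ.Prime).ne_zero
    refine Set.Finite.eventually_cofinite_notMem ((Ideal.finite_factors h0).subset fun v hv => ?_)
    change v.asIdeal ∣ Ideal.span {((ℓ : ℕ) : 𝓞 F)}
    rw [Ideal.dvd_span_singleton]
    exact hv
  filter_upwards [hfin.eventually_cofinite_notMem, away] with v hv hvℓ
  obtain ⟨hu, hP⟩ := hρ v hv hvℓ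
  exact ⟨α v, hα v (fun h => hv (Set.mem_union_right _ h)), hu, hP⟩

end Summit.Langlands.Langlands.Theorems.DegenerateLimitsTargetOfCruxes
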